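import Literature.Geometry.Riemannian.ShrinkerPotentialGrowth
import Literature.Geometry.Riemannian.CompactSolitonScalarCurvature
import HarnessLib

/-!
# Complete gradient shrinking Ricci solitons have nonnegative scalar curvature
# (Z.-H. Zhang 2009, Thm. 1.3 (ii); B.-L. Chen 2009, Cor. 2.5) — named fact

For a complete connected gradient shrinking Ricci soliton `(Mⁿ, g, f)`, `Ric + Hess f = g/2`,
normalised by `R + |∇f|² = f`, the scalar curvature is nonnegative, `R ≥ 0`, WITHOUT any curvature
assumption. Sources, as printed:

* Z.-H. Zhang, *On the completeness of gradient Ricci solitons*, Proc. AMS 137 (2009) 2755–2759 =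
  arXiv:0807.1581 [Zhang2009], Theorem 1.3 (read in the arXiv text, pp. 1–5): "Let `(M,g,f)` be a
  gradient Ricci soliton. Suppose the metric `g` is complete, then we have: (i) `∇f` is complete;
  (ii) `R ≥ 0`, if the soliton is steady or shrinking; (iii) `∃ C ≥ 0`, such that `R ≥ −C`, if
  the soliton is expanding." The proof of (ii) (Step 1, p. 4) is elliptic and one page long:
  Prop. 2.2 (i) `ΔR = ⟨∇f, ∇R⟩ + 2λR − 2|Ric|²` (in the tree: Hamilton's identity
  `dalembertian_scalarCurvature_of_soliton`, `GradientSolitonIdentities.lean`); Prop. 2.2 (ii), the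
  `f`-Laplacian comparison for the distance `d = d(p, ·)` from local data only — "Suppose
  `Ric ≤ (n−1)K` on `B_{r₀}(p)` … Then for arbitrary point `x` outside `B_{r₀}(p)`,
  `Δd − ⟨∇f, ∇d⟩ ≤ −λ d(x) + (n−1){⅔Kr₀ + r₀⁻¹} + |∇f|(p)`" (index comparison with Perelman's
  vector fields, in the barrier sense at cut points); and the minimum principle for the cut-off
  function `u = φ(d/(Ar₀)) R`, giving `R ≥ −C(φ, n)/(A r₀²)` on `B_{Ar₀/2}(p)` for every `A > 2`.
* B.-L. Chen, *Strong uniqueness of the Ricci flow*, J. Differential Geom. 82 (2009) 363–382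
  [Chen2009], Cor. 2.5: complete ancient solutions of the Ricci flow have `R ≥ 0` (the parabolic
  original of the argument; applies to the soliton's canonical flow once `∇f` is complete,
  Zhang Thm. 1.3 (i)).
* Quoted as (2.6) in R. Haslhofer, R. Müller, GAFA 21 (2011), §2 [HaslhoferMuller2011]:
  "Gradient shrinkers always have nonnegative scalar curvature … see [Zha09] for a proof in the
  noncompact case without curvature assumptions."

## Rendering and role

`shrinkerScalarCurvature_nonneg` is clause (a) of the bundled named fact `shrinkerPotentialGrowth`
(`ShrinkerPotentialGrowth.lean`: (2.6) + Lemma 2.1 + Lemma 2.2 of Haslhofer–Müller), over the same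
binder (any dimension `n`, complete = closed `g.edist`-balls compact, Levi-Civita connection, `f`
smooth, `Ric + Hess f = g/2`, `R + |∇f|² = f`), isolated because it is the KEYSTONE of that bundle and
of the shrinker LSI: `ShrinkerPotentialGrowthProofs.lean` proves Lemma 2.1 from it
(`potential_lower_of_scalarCurvature_nonneg`, `exists_forall_potential_le`) and reduces the bundle to
it plus Lemma 2.2 (`shrinkerPotentialGrowth_of_nonneg_of_volume`, whose hypothesis `hA` is this
statement verbatim), and `ShrinkerEntropyProofs.lean` reduces clauses (i), (iii) of
`CarrilloNi2009_shrinkerLSI` to it (`clauses_i_iii_of_proper` + properness from Lemma 2.1). First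
user: crux line `collapsed-ends-usc` of `EntropyRung.NoncompactShrinkerGap` (Summits/SmoothPoincare4,
skeleton v5: registered stub `stub_scalarCurvatureNonneg` = this statement; the landed stubs
`stub_compactSupportLSI_of_nonneg`, `stub_modelValueSplitLine_of_nonneg` take it as antecedent).
Proved here: the compact case (`shrinkerScalarCurvature_nonneg.of_compactSpace`, from the tree's
`scalarCurvature_nonneg_of_compactSpace_soliton`) and the projection from the bundle
(`shrinkerScalarCurvature_nonneg_of_shrinkerPotentialGrowth`). NOT here: Zhang's Step 1 — the
`f`-Laplacian comparison for the distance function from local curvature data and the Calabi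
barrier argument at a minimum of `φ(d/(Ar₀)) R` are not in the tree.

## References

* [Zhang2009] Z.-H. Zhang, Proc. Amer. Math. Soc. 137 (2009) 2755–2759 = arXiv:0807.1581:
  Thm. 1.3 (ii), Prop. 2.2, proof Step 1 (pp. 3–5 of the arXiv text). READ.
* [Chen2009] B.-L. Chen, J. Differential Geom. 82 (2009) 363–382: Cor. 2.5.
* [HaslhoferMuller2011] R. Haslhofer, R. Müller, GAFA 21 (2011) = arXiv:1005.3255: §2, (2.6).
-/

noncomputable section

open scoped Manifold ContDiff Topology ENNReal NNReal
open Set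

namespace Literature.Geometry.Riemannian

open Lorentzian

/-- **Zhang 2009, Thm. 1.3 (ii) / Chen 2009, Cor. 2.5 / Haslhofer–Müller 2011, (2.6)**: a complete
connected gradient shrinking Ricci soliton `Ric + Hess f = g/2` normalised by `R + |∇f|² = f` (closed
`g.edist`-balls compact, Levi-Civita connection, `f` smooth), in any dimension `n`, has nonnegative
scalar curvature: `∀ x, 0 ≤ R(x)`. Named fact (D-0014); the hypothesis `hA` of
`shrinkerPotentialGrowth_of_nonneg_of_volume` verbatim.
[cite: Zhang2009, Thm. 1.3 (ii), Prop. 2.2, proof Step 1 (arXiv pp. 3–5)] [cite: Chen2009, Cor. 2.5]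
[cite: HaslhoferMuller2011, §2 (2.6) (p. 5)] -/
def shrinkerScalarCurvature_nonneg : Prop :=
  ∀ (n : ℕ) (M : Type) [TopologicalSpace M] [T2Space M] [SecondCountableTopology M]
    [ChartedSpace (EuclideanSpace ℝ (Fin n)) M] [IsManifold (𝓡 n) ∞ M] [ConnectedSpace M]
    [T3Space M] [MeasurableSpace M] [BorelSpace M]
    (g : PseudoRiemannianMetric (𝓡 n) ∞ (EuclideanSpace ℝ (Fin n)) (TangentSpace (𝓡 n) : M → Type _))
    [g.HasLeviCivita] (f : M → ℝ) (hg : g.IsRiemannian),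
    (∀ (x : M) (r : NNReal), IsCompact {y : M | g.edist hg x y ≤ r}) →
    ContMDiff (𝓡 n) 𝓘(ℝ, ℝ) ∞ f →
    (∀ (x : M) (X Y : TangentSpace (𝓡 n) x),
      g.ricci x X Y + g.hessian f x X Y = (1 / 2 : ℝ) * g.val x X Y) →
    (∀ x : M, g.scalarCurvature x + g.gradSq f x = f x) →
    ∀ x : M, 0 ≤ g.scalarCurvature x

/-- The bundled Haslhofer–Müller fact `shrinkerPotentialGrowth` ((2.6) + Lemmas 2.1–2.2) contains
(2.6) as its clause (a). [cite: HaslhoferMuller2011, §2 (2.6) (p. 5)] -/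
theorem shrinkerScalarCurvature_nonneg_of_shrinkerPotentialGrowth (h : shrinkerPotentialGrowth) :
    shrinkerScalarCurvature_nonneg := by
  intro n M _ _ _ _ _ _ _ _ _ g _ f hg hc hf hsol hnorm
  obtain ⟨C₂, hC₂⟩ := h n
  exact (hC₂ M g f hg hc hf hsol hnorm).1

/-- **The compact case is a theorem of the tree**: on a COMPACT member of the binder, `R ≥ 0` by the
minimum principle (`scalarCurvature_nonneg_of_compactSpace_soliton`, Eminenti–La Nave–Mantegazza
2008, §3); so the content of the fact is the complete non-compact case (Zhang's Step 1).
[cite: Zhang2009, Thm. 1.3 (ii)] -/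
theorem shrinkerScalarCurvature_nonneg.of_compactSpace (n : ℕ) (M : Type) [TopologicalSpace M]
    [ChartedSpace (EuclideanSpace ℝ (Fin n)) M] [IsManifold (𝓡 n) ∞ M] [CompactSpace M]
    (g : PseudoRiemannianMetric (𝓡 n) ∞ (EuclideanSpace ℝ (Fin n)) (TangentSpace (𝓡 n) : M → Type _))
    [g.HasLeviCivita] (f : M → ℝ) (hg : g.IsRiemannian) (hf : ContMDiff (𝓡 n) 𝓘(ℝ, ℝ) ∞ f)
    (hsol : ∀ (x : M) (X Y : TangentSpace (𝓡 n) x),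
      g.ricci x X Y + g.hessian f x X Y = (1 / 2 : ℝ) * g.val x X Y) (x : M) :
    0 ≤ g.scalarCurvature x :=
  scalarCurvature_nonneg_of_compactSpace_soliton g hg hf (by norm_num) hsol x

end Literature.Geometry.Riemannian

end
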